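import Summits.BirchSwinnertonDyer.Rank1Residual.X2.RouteGSplitDisplay29910e1
import Summits.BirchSwinnertonDyer.Rank1Residual.X2.TwistParityStability
import HarnessLib

/-!
# Route G at a SPLIT multiplicative Eisenstein `3` — the pair `29910e1 @ 3 ← 91724c1 @ 3`: the GALOIS-SIDE
# cell datum `¬ GVPar W 3` DISCHARGED IN THE KERNEL by an explicit rational `3`-torsion point (cell `bsd-eis`,
# seat `bsd-eis-k5-c3` g2, GENERATED by `work/gen_notgv.py`; THEOREMS ONLY; answers planner Q-g15-1)

HONEST FRAMING (FULL-BSD rank-≤1 programme D-0033, cell `bsd-eis`, home `run/shared/lean/pub/bsd-eis/`; row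
A10-split: 83 cells `(E₀, 3)`, `r = 0`, split multiplicative Eisenstein `3`, `¬GVPar`). Nothing booked, no label
moves. The X1-relative ("xone") display `X2/RouteGSplitDisplay29910e1.lean` carries the Galois-side HYPOTHESIS
`hngv : ¬ GVPar W 3` (used to place the closed good anomalous relative `91724c1` in `ClassX1` via
`not_gvPar_of_torsionIso_of_not_gvPar`). Here it is PROVED: `P = (5084, 20895) ∈ E(ℚ)` is a point of order `3` on
`W = 29910e1 = [1, 0, 1, -83332773, 292800237328]` (`Ψ₃(5084) = 0`, `Ψ₂Sq(5084) = 2197265625 ≠ 0`;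
`RouteGThreeTorsion.addOrderOf_eq_three_of_eval_Ψ₃`), so the rational line it spans is unramified and even, i.e. NOT
of Greenberg–Vatsal type, and at an odd MULTIPLICATIVE prime that forces `¬ GVPar`
(`X2.not_gvPar_of_nsmul_eq_zero_of_mult`, granted the two Tate-uniformisation facts `hT`, `hT'` that the display
already binds). The two heads below are the display's heads with `hngv` REMOVED (R246.1 standard: Galois side in
the kernel); every other binder is verbatim. PER-PAIR CERTIFICATE HYPOTHESES LEFT [instrument]: `hr'`, `hunit'`,
`hμ0`, `hlam`, `hμ0'`, `hlam'`, `hk`, `hn`.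
Refs: [GreenbergVatsal2000] Thm (1.3), §2 p. 28; [SilvermanAEC2009] III Ex. 3.7, VII.3; [SilvermanATAEC1994] V.5.3.
-/

set_option autoImplicit false

noncomputable section

open scoped Classical

open WeierstrassCurve NumberField IsDedekindDomain
  Literature.NumberTheory.EllipticCurves
  Literature.NumberTheory.EllipticCurves.ModularForms
  Literature.NumberTheory.EllipticCurves.Rank1Residual
  Literature.NumberTheory.EllipticCurves.Rank1Residual.Typed
  Literature.NumberTheory.EllipticCurves.Rank1Residual.X11RankOneCertificates
  Literature.NumberTheory.EllipticCurves.Wuthrich2014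
  Literature.NumberTheory.EllipticCurves.SteinWuthrich2013
  Literature.NumberTheory.EllipticCurves.Greenberg1999
  Literature.NumberTheory.EllipticCurves.GreenbergVatsal2000
  Summit.BirchSwinnertonDyer.BirchSwinnertonDyer.Rank1Residual.IntModel
  Summit.BirchSwinnertonDyer.BirchSwinnertonDyer.Rank1Residual.X11RankOne
  Summit.BirchSwinnertonDyer.Rank1Residual.X11b
  Summit.BirchSwinnertonDyer.Rank1Residual.X1.CongruenceTransfer
  Summit.BirchSwinnertonDyer.Rank1Residual.X2.LocalDeltaCalculus
  Summit.BirchSwinnertonDyer.Rank1Residual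
  Summit.BirchSwinnertonDyer.Rank1Residual.X2.RouteGSplitDisplay29910e1Local
  Summit.BirchSwinnertonDyer.BirchSwinnertonDyer.Theorems.Rank1ResidualX1Defs
  Summit.BirchSwinnertonDyer.BirchSwinnertonDyer.Theorems

namespace Summit.BirchSwinnertonDyer.Rank1Residual.X2.RouteGSplitDisplay29910e1

/-! ## §1 The rational `3`-torsion point and `¬ GVPar` in the kernel -/

/-- **`P = (5084, 20895)` is a rational point of order `3` on `29910e1 = [1, 0, 1, -83332773, 292800237328]`** (`Ψ₃(5084) = 0`,
`Ψ₂Sq(5084) = 2197265625 ≠ 0`; Silverman III Ex. 3.7 in the tree's kernel form). [cite: SilvermanAEC2009, III Ex. 3.7] -/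
theorem addOrderOf_torsionPoint_29910e1
    (hP : (⟨1, 0, 1, -83332773, 292800237328⟩ : WeierstrassCurve ℚ).toAffine.Nonsingular (5084 : ℚ) (20895 : ℚ)) :
    addOrderOf (Affine.Point.some (5084 : ℚ) (20895 : ℚ) hP) = 3 := by
  haveI := isElliptic_29910e1
  exact RouteGThreeTorsion.addOrderOf_eq_three_of_eval_Ψ₃ _ hP
    (by norm_num [WeierstrassCurve.Ψ₃, WeierstrassCurve.b₂, WeierstrassCurve.b₄, WeierstrassCurve.b₆,
          WeierstrassCurve.b₈])
    (by rw [KernelDisc.eval_Ψ₂Sq]; norm_num [WeierstrassCurve.b₂, WeierstrassCurve.b₄, WeierstrassCurve.b₆])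

/-- **`¬ GVPar (29910e1) 3` — the cell datum of row A10 IN THE KERNEL**: the rational `3`-torsion point `(5084, 20895)`
spans a rational line that is unramified at `3` and even, hence of co-type, and at the odd SPLIT multiplicative prime
`3` one co-type line forces type A (`X2.not_gvPar_of_nsmul_eq_zero_of_mult`; Tate uniformisation `hT`, `hT'` as in the
display). [cite: GreenbergVatsal2000, Thm. (1.3) and §2 p. 28] [cite: SilvermanATAEC1994, Thm. V.5.3 and Cor. V.5.4] -/
theorem not_gvPar_29910e1
    (hT : Silverman1994_thmV53_corV54_tateUniformisation.{0})
    (hT' : Silverman1994_thmV53_tateUniformisation.{0}) :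
    ¬ GVPar (⟨1, 0, 1, -83332773, 292800237328⟩ : WeierstrassCurve ℚ) 3 := by
  haveI := isElliptic_29910e1
  haveI := isGloballyMinimal_29910e1
  have hP : (⟨1, 0, 1, -83332773, 292800237328⟩ : WeierstrassCurve ℚ).toAffine.Nonsingular (5084 : ℚ) (20895 : ℚ) :=
    WeierstrassCurve.Affine.equation_iff_nonsingular.mp
      ((WeierstrassCurve.Affine.equation_iff _ _).mpr (by norm_num))
  have h3 : (3 : ℕ) • (Affine.Point.some (5084 : ℚ) (20895 : ℚ) hP) = 0 :=
    addOrderOf_torsionPoint_29910e1 hP ▸ addOrderOf_nsmul_eq_zero _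
  exact not_gvPar_of_nsmul_eq_zero_of_mult _ hT' hT (by decide) split_29910e1.hasMultiplicativeReductionAtPrime
    _ (Affine.Point.some_ne_zero hP) h3

/-! ## §2 The display heads without the Galois-side binder `hngv` -/

/-- **ROUTE G DISPLAY `X2.MazurMainConjectureAt 29910e1 3`, Galois side ENTIRELY in the kernel** — the head
`mazurMainConjectureAt_29910e1_at_three` of part 2 with its binder `hngv : ¬ GVPar W 3` discharged by
`not_gvPar_29910e1`; all other binders verbatim (REGISTERED [PUB] facts + the per-pair INSTRUMENT certificates
`hr'`, `hunit'`, `hμ0`, `hlam`, `hμ0'`, `hlam'`, `hk`, `hn`). Nothing booked.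
[cite: GreenbergVatsal2000, Thm. (1.4), §1 (5)–(7), §2 Prop. (2.4) pp. 20–27] [cite: Wuthrich2014, Thm. 16 (p. 397)]
[cite: SteinWuthrich2013, Thm. 6.1 (p. 20), clause (1)] [cite: Fisher2012Hessian, §13] -/
theorem mazurMainConjectureAt_29910e1_at_three'
    (hWu : thm16_charIdeal_dvd_multiplicative_of_reducible)
    (hW16 : Wuthrich2014.charIdeal_dvd_padicLFunction) (hW21 : sha_dvd_analyticSha)
    (hGr : greenberg_charValue_rankZero)
    (hGZK : rank_eq_analyticRank_of_analyticRank_le_one) (hmod : hasEntireLFunction_rat)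
    (hpar : nonempty_modularParametrizationData)
    (hT : Silverman1994_thmV53_corV54_tateUniformisation.{0})
    (hT' : Silverman1994_thmV53_tateUniformisation.{0})
    (hAm : lambda_nonPrimitive_eq_add_sum_delta_multiplicative)
    (hBm : datumSelmer_divisible_of_finite_torsionBy) (hF : datumStrictSelmer_lt_datumSelmer_of_split)
    (hGV : imKummer_ge_greenbergCondition_at_p) (hA7 : lambda_nonPrimitive_eq_add_sum_delta)
    (hB : divisible_nonPrimitiveSelmerInfty_of_mu_eq_zero)
    (W W' : WeierstrassCurve ℚ) [W.IsElliptic] [W.IsGloballyMinimal] [W'.IsElliptic]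
    [W'.IsGloballyMinimal] (hW : W = ⟨1, 0, 1, -83332773, 292800237328⟩)
    (hW' : W' = ⟨0, 1, 0, -4388578, 3546513937⟩)
    (n n' k : ℕ) (hr' : W'.analyticRank = 0) (hunit' : ∃ q : ℚ, shaAn W' = (q : ℂ) ∧ padicValRat 3 q = 0)
    (hμ0 : AnalyticMuLE W 3 0) (hlam : AnalyticLambdaEq W 3 n)
    (hμ0' : X1.MuPart.AnalyticMuLE W' 3 0) (hlam' : X1.ParitySqueeze.AnalyticLambdaEq W' 3 n')
    (hk : (k : ℤ) = n' + (-1) - 1) (hn : n ≤ k + 1) :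
    X2.MazurMainConjectureAt W 3 := by
  have hngv : ¬ GVPar W 3 := by subst hW; exact not_gvPar_29910e1 hT hT'
  exact mazurMainConjectureAt_29910e1_at_three hWu hW16 hW21 hGr hGZK hmod hpar hT hT' hAm hBm hF hGV hA7 hB W W' hW
    hW' hngv n n' k hr' hunit' hμ0 hlam hμ0' hlam' hk hn

/-- **`BSD(29910e1, 3)`, Galois side ENTIRELY in the kernel** — the head `bsdp_29910e1_at_three` of part 2 with
`hngv` discharged by `not_gvPar_29910e1`; all other binders verbatim. Nothing booked.
[cite: GreenbergVatsal2000, Thm. (1.4), §2 Prop. (2.4)] [cite: Wuthrich2014, Thm. 16 (p. 397)]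
[cite: SteinWuthrich2013, Thm. 6.1 (p. 20)] [cite: MazurTateTeitelbaum1986Invent, Ch. II §10 Conjecture (BSD(p)) (p. 38)]
[cite: Miller2011LMS, Def. 1.1] -/
theorem bsdp_29910e1_at_three'
    (hWu : thm16_charIdeal_dvd_multiplicative_of_reducible)
    (hW16 : Wuthrich2014.charIdeal_dvd_padicLFunction) (hW21 : sha_dvd_analyticSha)
    (hGr : greenberg_charValue_rankZero)
    (hJs : thm61_splitMultiplicative) (hJn : thm61_nonsplitMultiplicative)
    (hHs : exists_isSplitMultCanonical) (hHn : exists_isMultCanonical)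
    (hGZK : rank_eq_analyticRank_of_analyticRank_le_one) (hmod : hasEntireLFunction_rat)
    (hpar : nonempty_modularParametrizationData)
    (hT : Silverman1994_thmV53_corV54_tateUniformisation.{0})
    (hT' : Silverman1994_thmV53_tateUniformisation.{0})
    (hAm : lambda_nonPrimitive_eq_add_sum_delta_multiplicative)
    (hBm : datumSelmer_divisible_of_finite_torsionBy) (hF : datumStrictSelmer_lt_datumSelmer_of_split)
    (hGV : imKummer_ge_greenbergCondition_at_p) (hA7 : lambda_nonPrimitive_eq_add_sum_delta)
    (hB : divisible_nonPrimitiveSelmerInfty_of_mu_eq_zero)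
    (W W' : WeierstrassCurve ℚ) [W.IsElliptic] [W.IsGloballyMinimal] [W'.IsElliptic]
    [W'.IsGloballyMinimal] (hW : W = ⟨1, 0, 1, -83332773, 292800237328⟩)
    (hW' : W' = ⟨0, 1, 0, -4388578, 3546513937⟩)
    (hGS : greenberg_stevens (W := W) (p := 3))
    (hr : W.analyticRank = 0)
    (n n' k : ℕ) (hr' : W'.analyticRank = 0) (hunit' : ∃ q : ℚ, shaAn W' = (q : ℂ) ∧ padicValRat 3 q = 0)
    (hμ0 : AnalyticMuLE W 3 0) (hlam : AnalyticLambdaEq W 3 n)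
    (hμ0' : X1.MuPart.AnalyticMuLE W' 3 0) (hlam' : X1.ParitySqueeze.AnalyticLambdaEq W' 3 n')
    (hk : (k : ℤ) = n' + (-1) - 1) (hn : n ≤ k + 1) :
    BSDp W 3 := by
  have hngv : ¬ GVPar W 3 := by subst hW; exact not_gvPar_29910e1 hT hT'
  exact bsdp_29910e1_at_three hWu hW16 hW21 hGr hJs hJn hHs hHn hGZK hmod hpar hT hT' hAm hBm hF hGV hA7 hB W W' hW
    hW' hGS hr hngv n n' k hr' hunit' hμ0 hlam hμ0' hlam' hk hn

end Summit.BirchSwinnertonDyer.Rank1Residual.X2.RouteGSplitDisplay29910e1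

end
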